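import Mathlib.LinearAlgebra.Matrix.ToLin
import Mathlib.LinearAlgebra.Dimension.Free
import Mathlib.LinearAlgebra.FiniteDimensional.Basic
import Mathlib.LinearAlgebra.FiniteDimensional.Lemmas
import Mathlib.LinearAlgebra.FreeModule.Finite.Matrix
import Mathlib.RingTheory.Nilpotent.Defs
import HarnessLib

/-!
# An algebra of `Z`-linear operators of `k`-dimension `(dim_k V)² / [Z : k]` is ALL of `End_Z(V)`, and contains a
# commutative reduced subalgebra of dimension `dim_k V` (the diagonal of a `Z`-basis)

The dimension count behind «multiplicity one ⟹ complex multiplication» ([Liu2021] App. D §D.4, l. 5626–5627, «Using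
Hecke operators … `B_0` has complex multiplications»; G. Shimura, *Abelian Varieties with Complex Multiplication and
Modular Functions* (1998) §5.1 Proposition 1 (p. 36) — the extremal case `[𝔖 : ℚ] = 2 dim A` — and Propositions 3–4
(p. 37)): if a `k`-algebra `H` of operators on `V` commutes with a FIELD `Z` of scalars (`k ⊆ Z`, `V` a `Z`-vector space)
and `[Z : k] · dim_k H = (dim_k V)²`, then `dim_Z H = (dim_Z V)²`, so `H = End_Z(V) ≅ M_d(Z)` (`d = dim_Z V`) — the faithful
module of the minimal dimension forces the central simple algebra to SPLIT, with no appeal to the theory of maximal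
subfields — and the DIAGONAL operators of any `Z`-basis form a commutative reduced subalgebra `≅ Z^d` of `k`-dimension
`d·[Z:k] = dim_k V`.

THIS FILE (theorems only; pure Mathlib; any field `k`, any field `Z ⊇ k` acting on `V` with `IsScalarTower k Z V`):
* `finrank_end_eq_mul_sq` — `dim_k End_Z(V) = [Z:k] · (dim_Z V)²`;
* **`mem_of_forall_map_smul_of_finrank_eq`** — (a): if `H ⊆ End_Z(V)` (as a `k`-subalgebra of `End_k(V)`) has
  `[Z:k] · dim_k H = (dim_k V)²`, then EVERY `Z`-linear endomorphism lies in `H` (`H = End_Z(V)`);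
* **`exists_comm_isReduced_subalgebra_finrank_eq`** — (b): such an `H` contains a commutative reduced `k`-subalgebra
  `R` with `dim_k R = dim_k V`.

DICTIONARY LINE (cell `hodgecm-mathlib`, crux `HLiu418` = stmt-HodgeConjecture-24832, d6 S2′ road (6-i), step «(R-split)»):
`V := H¹_B(Im u₀ ⊗ ℂ, ℚ)` (`dim 2g`), `H :=` the image of the level-`K` Hecke algebra on the `ω⋆`-block (faithful, SIMPLE,
centre `Z` a number field with `[Z:ℚ]·dim H = (2g)²` by multiplicity one); (b) is the «commutative reduced `R` of degree
`2 dim`» consumed by ★ `exists_quasiIdempotent_image_isSimple_numberField_of_comm_isReduced` (after ★ `bettiRep`).  The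
file moves no book (HC_CM is proved only modulo the 7 printed citations until rung 0 closes).

## References
* [Shimura1998] G. Shimura, *Abelian Varieties with Complex Multiplication and Modular Functions*, Princeton (1998),
  §5.1 Proposition 1 (p. 36), Propositions 3 and 4 (p. 37).
* [Liu2021] Y. Liu, *Fourier–Jacobi cycles and arithmetic relative trace formula*, Camb. J. Math. 9 (2021), App. D §D.4
  (FJcycle.tex l. 5626–5627).
-/

namespace Literature.RingTheory.SimpleModule

open Module

universe u v w

section Main

variable (k : Type u) [Field k] (Z : Type v) [Field Z] [Algebra k Z] (V : Type w) [AddCommGroup V] [Module k V]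
  [Module Z V] [IsScalarTower k Z V] [FiniteDimensional k Z] [FiniteDimensional Z V]

omit [FiniteDimensional k Z] in
/-- **`dim_k End_Z(V) = [Z : k] · (dim_Z V)²`** (tower law and `dim_Z End_Z(V) = (dim_Z V)²`).
[cite: Shimura1998, §5.1 Proposition 1 (p. 36)] -/
theorem finrank_end_eq_mul_sq : finrank k (Module.End Z V) = finrank k Z * finrank Z V ^ 2 := by
  rw [← Module.finrank_mul_finrank k Z (Module.End Z V), Module.finrank_linearMap Z Z V V, sq]

variable {k Z V}

/-- **(a) An algebra of `Z`-linear operators of `k`-dimension `(dim_k V)²/[Z:k]` is all of `End_Z(V)`.**  Let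
`H ⊆ End_k(V)` be a `k`-subalgebra whose elements are `Z`-linear (`H` commutes with the field of scalars `Z ⊇ k`) and
with `[Z : k] · dim_k H = (dim_k V)²`.  Then every `Z`-linear endomorphism of `V` lies in `H` — `H = End_Z(V) ≅ M_d(Z)`,
`d = dim_Z V`: the central simple algebra is split by the dimension count alone.
[cite: Shimura1998, §5.1 Proposition 1 (p. 36), Propositions 3 and 4 (p. 37)] [cite: Liu2021, App. D §D.4 (FJcycle.tex l. 5626–5627)] -/
theorem mem_of_forall_map_smul_of_finrank_eq (H : Subalgebra k (Module.End k V))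
    (hHZ : ∀ h ∈ H, ∀ (z : Z) (v : V), h (z • v) = z • h v)
    (hdim : finrank k Z * finrank k H = finrank k V ^ 2)
    (f : Module.End k V) (hf : ∀ (z : Z) (v : V), f (z • v) = z • f v) : f ∈ H := by
  haveI : FiniteDimensional k V := Module.Finite.trans Z V
  -- restriction of scalars `End_Z(V) →ₐ[k] End_k(V)` and its range `E`
  let ρ : Module.End Z V →ₐ[k] Module.End k V :=
    { toFun := fun g => g.restrictScalars k
      map_one' := rfl
      map_mul' := fun _ _ => rfl
      map_zero' := rfl
      map_add' := fun _ _ => rfl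
      commutes' := fun c => by ext v; simp [Algebra.algebraMap_eq_smul_one] }
  have hρ : Function.Injective ρ := LinearMap.restrictScalars_injective k
  -- `H ≤ range ρ`
  have hle : H ≤ ρ.range := fun h hh =>
    ⟨{ toFun := h, map_add' := map_add h, map_smul' := fun z v => hHZ h hh z v }, rfl⟩
  -- dimensions: `dim_k (range ρ) = [Z:k] d²` and `dim_k V = [Z:k] d`
  have hrange : finrank k ρ.range = finrank k Z * finrank Z V ^ 2 := by
    rw [← (AlgEquiv.ofInjective ρ hρ).toLinearEquiv.finrank_eq, finrank_end_eq_mul_sq k Z V]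
  have hV : finrank k V = finrank k Z * finrank Z V := (Module.finrank_mul_finrank k Z V).symm
  have hZpos : 0 < finrank k Z := finrank_pos
  have hH : finrank k H = finrank k Z * finrank Z V ^ 2 := by
    have h2 : finrank k Z * finrank k H = finrank k Z * (finrank k Z * finrank Z V ^ 2) := by
      rw [hdim, hV]; ring
    exact Nat.eq_of_mul_eq_mul_left hZpos h2
  have heq : H = ρ.range := Subalgebra.eq_of_le_of_finrank_eq hle (by rw [hH, hrange])
  -- `f` is `Z`-linear, hence in the range
  have hf' : f ∈ ρ.range := ⟨{ toFun := f, map_add' := map_add f, map_smul' := hf }, rfl⟩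
  rw [heq]
  exact hf'

/-- **(b) … and contains a commutative reduced subalgebra of dimension `dim_k V`** — the DIAGONAL operators of a
`Z`-basis of `V` (`≅ Z^d`): the «commutative semisimple subalgebra of degree `2 dim`» of Shimura §5.1 Prop. 1's extremal
case, produced from multiplicity one by linear algebra alone.
[cite: Shimura1998, §5.1 Proposition 1 (p. 36), Propositions 3 and 4 (p. 37)] [cite: Liu2021, App. D §D.4 (FJcycle.tex l. 5626–5627)] -/
theorem exists_comm_isReduced_subalgebra_finrank_eq (H : Subalgebra k (Module.End k V))
    (hHZ : ∀ h ∈ H, ∀ (z : Z) (v : V), h (z • v) = z • h v)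
    (hdim : finrank k Z * finrank k H = finrank k V ^ 2) :
    ∃ R : Subalgebra k (Module.End k V), R ≤ H ∧ (∀ x ∈ R, ∀ y ∈ R, x * y = y * x) ∧ IsReduced R ∧
      finrank k R = finrank k V := by
  classical
  haveI : FiniteDimensional k V := Module.Finite.trans Z V
  let d := finrank Z V
  let b : Module.Basis (Fin d) Z V := Module.finBasis Z V
  -- the diagonal `k`-algebra homomorphism `Z^d → M_d(Z) ≅ End_Z(V) → End_k(V)`
  let ρ : Module.End Z V →ₐ[k] Module.End k V :=
    { toFun := fun g => g.restrictScalars k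
      map_one' := rfl
      map_mul' := fun _ _ => rfl
      map_zero' := rfl
      map_add' := fun _ _ => rfl
      commutes' := fun c => by ext v; simp [Algebra.algebraMap_eq_smul_one] }
  have hρ : Function.Injective ρ := LinearMap.restrictScalars_injective k
  let δ : (Fin d → Z) →ₐ[k] Module.End k V :=
    ρ.comp (((Matrix.toLinAlgEquiv b).toAlgHom.restrictScalars k).comp
      ((Matrix.diagonalAlgHom Z).restrictScalars k))
  have hδ : Function.Injective δ := by
    intro x y hxy
    have h1 : (Matrix.toLinAlgEquiv b) (Matrix.diagonal x) = (Matrix.toLinAlgEquiv b) (Matrix.diagonal y) := hρ hxy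
    exact Matrix.diagonal_injective ((Matrix.toLinAlgEquiv b).injective h1)
  refine ⟨δ.range, ?_, ?_, ?_, ?_⟩
  · -- `R ≤ H`: its elements are `Z`-linear, and `H` is all of `End_Z(V)` by (a)
    rintro _ ⟨c, rfl⟩
    refine mem_of_forall_map_smul_of_finrank_eq H hHZ hdim _ fun z v => ?_
    change ((Matrix.toLinAlgEquiv b) (Matrix.diagonal c)) (z • v) = z • ((Matrix.toLinAlgEquiv b) (Matrix.diagonal c)) v
    exact map_smul _ z v
  · -- commutative: image of the commutative algebra `Z^d`
    rintro _ ⟨c, rfl⟩ _ ⟨c', rfl⟩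
    rw [← map_mul, ← map_mul, mul_comm]
  · -- reduced: `R ≅ Z^d`
    haveI : IsReduced (Fin d → Z) := inferInstance
    exact isReduced_of_injective (AlgEquiv.ofInjective δ hδ).symm.toRingEquiv.toRingHom
      (AlgEquiv.ofInjective δ hδ).symm.injective
  · -- dimension `d · [Z:k] = dim_k V`
    rw [← (AlgEquiv.ofInjective δ hδ).toLinearEquiv.finrank_eq, Module.finrank_pi_fintype k, Finset.sum_const,
      Finset.card_univ, Fintype.card_fin, smul_eq_mul, ← Module.finrank_mul_finrank k Z V, mul_comm]

end Main

end Literature.RingTheory.SimpleModule
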